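import Literature.Computability.MetaComplexity.ProbabilisticDegreeThreshold
import HarnessLib

/-!
# The probabilistic degree of `t`-constant symmetric functions (Srinivasan–Tripathi–Venkitesh 2021, Cor. 19)

Srinivasan–Tripathi–Venkitesh, *On the probabilistic degrees of symmetric Boolean functions*
(SIAM J. Discrete Math. 2021 / FSTTCS 2019), §3.1: a symmetric Boolean function `f` on `{0,1}ⁿ`
is **`t`-constant** (Def. 14) if its spectrum is constant on the weights `[t, n]`; such an `f` is a
`{−1,0,1}`-combination of the thresholds `Thr_n^0, …, Thr_n^t` (Obs. 15), so — the probabilistic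
poly-TUPLE of the thresholds having JOINT error `ε` (Def. 16, Thm. 18) — `pdeg_ε(f)` is at most the
degree of the threshold tuple: `O(√(t log(1/ε)) + log(1/ε))` in positive characteristic
(Cor. 19). Everything here is PROVED from the tree's discharged Theorem 18
(`ufam_thr_stv` / `STV2021_thresholdProbDegree_holds`, `ProbabilisticDegreeThreshold.lean`), in
the uniform-seed-family vocabulary `UFam` of `ThresholdProbDegreeStep.lean`, with the explicit
degree `stvDegree p t ε = ⌊A_p√(t log₂(1/ε)) + B_p log₂(1/ε)⌋`, `A_p = B_p = 6.4·10⁶·p`.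

* `IsTConstant t f` (STV Def. 14), `IsTConstant.mono`, `isTConstant_thrFn`, the exact-weight
  indicator `exactWtFn` (`(j+1)`-constant) and the SLICED symmetric functions `slicedFn n B σ`
  (`= σ(|x|)` on the promise slice `|x| ≤ B`, `false` above it; `(B+1)`-constant), in particular
  the promise parity `promiseParityFn n B` (`= PARITY` on `|x| ≤ B`);
* `tCoeff`, `sum_tCoeff`, `IsTConstant.boolVal_eq_sum` — Obs. 15: `[f x] = Σ_{j ≤ t} a_j [Thr_n^j x]`
  with `a_j = [Spec f(j)] − [Spec f(j−1)] ∈ {−1,0,1}`;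
* closure properties of seed families (Def. 16 as used in every polynomial-method proof):
  `ufam_of_linComb` (linear post-processing keeps degree and error), `UFam.comp` (composition
  with a map of cubes whose coordinates have `0/1`-indicators of degree `≤ d₀` multiplies the
  degree by `d₀` — `comp_mem_lowDeg_of_coord_mul`), `UFam.sumElim` (joining two families: errors
  add), `exists_seed_weighted_err_le` / `UFam.exists_realisation` (averaging: some seed errs on at
  most an `ε`-fraction of any weighted set of inputs — Razborov's "fix the randomness" step);
* **Cor. 19, tuple form**: `ufam_tConstant` — every finite family of `t`-constant functions has a
  seed family over `𝔽_p` of degree `≤ stvDegree p t ε` and JOINT error `≤ ε` (`ε < 2^{-100}`);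
  `STV2021_tConstantProbDegree` (`HasProbDegree` over `𝔽_p`), `STV2021_tConstantProbDegree_charP`
  (any field of characteristic `p`);
* the instance asked for by the shots ladder of the advice-free `QNC⁰` cell (a parity read under
  the promise "at most `B` ones", composed with `0/1`-valued maps of degree `≤ D`):
  `ufam_sliced_comp` / `ufam_promiseParity_comp` — degree `≤ stvDegree p (B+1) ε · D`, error `≤ ε`
  at EVERY input, and the value is the parity of the `m` bits wherever at most `B` of them are set
  (`promiseParityFn_comp_eq`).

Reading conventions as in `ProbabilisticDegreeThreshold.lean` (`log = log₂`, explicit constants,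
`ε < 2^{-100}`; the printed range `ε < 1/3` costs only constants, cf.
`STV2021_thresholdProbDegree_lt_third`). Deliberately NOT here: the characteristic-`0` case of
Cor. 19 (`Õ`), the converse lower bounds (STV §4), the standard decomposition into periodic and
bounded parts (STV §2, Lemma 23ff).

## References

* S. Srinivasan, U. Tripathi, S. Venkitesh, *On the probabilistic degrees of symmetric Boolean
  functions*, SIAM J. Discrete Math. 35 (2021); FSTTCS 2019; arXiv:1910.02465 — Def. 14, Obs. 15,
  Def. 16, Thm. 18, Cor. 19 [SrinivasanTripathiVenkitesh2021].
* S. Grewal, V. M. Kumar, arXiv:2408.16406 (2024), Thm. 3.8 (proof: composition along the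
  circuit, union bound, averaging over the seed) [GrewalKumar2024].
-/

noncomputable section

namespace Literature.Computability.MetaComplexity

open Finset Literature.Computability.Complexity

namespace Smolensky

/-! ### `t`-constant symmetric functions (STV Def. 14) and the examples used downstream -/

section TConstant

variable {n : ℕ}

/-- **`t`-constant symmetric Boolean function** (Srinivasan–Tripathi–Venkitesh 2021, Def. 14):
`f : {0,1}ⁿ → {0,1}` is symmetric with spectrum `s` (`f x = s(|x|)`) and `Spec f` is constant on
the weights `[t, n]`. [cite: SrinivasanTripathiVenkitesh2021, Definition 14] -/
def IsTConstant (t : ℕ) (f : (Fin n → Bool) → Bool) : Prop :=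
  ∃ s : ℕ → Bool, (∀ x, f x = s (GateFn.numOnes x)) ∧ ∀ k, t ≤ k → k ≤ n → s k = s t

/-- The Hamming weight of a point of `{0,1}ⁿ` is at most `n`. [folklore] -/
private theorem numOnes_le (x : Fin n → Bool) : GateFn.numOnes x ≤ n := by
  unfold GateFn.numOnes
  exact (Finset.card_le_univ _).trans (by simp)

/-- A `t`-constant function is `t'`-constant for every `t' ≥ t`. [cite: SrinivasanTripathiVenkitesh2021, Definition 14] -/
theorem IsTConstant.mono {t t' : ℕ} {f : (Fin n → Bool) → Bool} (h : IsTConstant t f)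
    (htt' : t ≤ t') : IsTConstant t' f := by
  obtain ⟨s, hs, hc⟩ := h
  refine ⟨s, hs, fun k hk hkn => ?_⟩
  rw [hc k (htt'.trans hk) hkn, hc t' htt' (hk.trans hkn)]

/-- The threshold `Thr_n^j` is `t`-constant for `j ≤ t` (its spectrum is `[j ≤ ·]`).
[cite: SrinivasanTripathiVenkitesh2021, Observation 15] -/
theorem isTConstant_thrFn {j t : ℕ} (hjt : j ≤ t) : IsTConstant t (thrFn n j) := by
  refine ⟨fun k => decide (j ≤ k), fun x => rfl, fun k hk _ => ?_⟩
  show decide (j ≤ k) = decide (j ≤ t)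
  rw [decide_eq_true (hjt.trans hk), decide_eq_true hjt]

/-- The exact-weight indicator `[|x| = j]`. [cite: SrinivasanTripathiVenkitesh2021, §2 (Some Boolean functions)] -/
def exactWtFn (n j : ℕ) : (Fin n → Bool) → Bool := fun x => decide (GateFn.numOnes x = j)

/-- `[|x| = j]` is `(j+1)`-constant. [cite: SrinivasanTripathiVenkitesh2021, Definition 14] -/
theorem isTConstant_exactWtFn (j : ℕ) : IsTConstant (j + 1) (exactWtFn n j) := by
  refine ⟨fun k => decide (k = j), fun x => rfl, fun k hk _ => ?_⟩
  show decide (k = j) = decide (j + 1 = j)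
  rw [decide_eq_false (by omega : ¬k = j), decide_eq_false (by omega : ¬j + 1 = j)]

/-- **A symmetric function SLICED at weight `B`**: `σ(|x|)` on the promise slice `|x| ≤ B` and
`false` above it (the total `(B+1)`-constant function that a partial symmetric function promised
`|x| ≤ B` extends to). [cite: SrinivasanTripathiVenkitesh2021, Definition 14] -/
def slicedFn (n B : ℕ) (σ : ℕ → Bool) : (Fin n → Bool) → Bool :=
  fun x => decide (GateFn.numOnes x ≤ B) && σ (GateFn.numOnes x)

/-- On the slice `|x| ≤ B` the sliced function is `σ(|x|)`. [cite: SrinivasanTripathiVenkitesh2021, Definition 14] -/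
theorem slicedFn_eq_of_le {B : ℕ} (σ : ℕ → Bool) {x : Fin n → Bool} (hx : GateFn.numOnes x ≤ B) :
    slicedFn n B σ x = σ (GateFn.numOnes x) := by
  simp [slicedFn, hx]

/-- Above the slice the sliced function is `false`. [cite: SrinivasanTripathiVenkitesh2021, Definition 14] -/
theorem slicedFn_eq_false_of_lt {B : ℕ} (σ : ℕ → Bool) {x : Fin n → Bool}
    (hx : B < GateFn.numOnes x) : slicedFn n B σ x = false := by
  simp [slicedFn, Nat.not_le.2 hx]

/-- A sliced symmetric function is `(B+1)`-constant. [cite: SrinivasanTripathiVenkitesh2021, Definition 14] -/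
theorem isTConstant_slicedFn (B : ℕ) (σ : ℕ → Bool) : IsTConstant (B + 1) (slicedFn n B σ) := by
  refine ⟨fun k => decide (k ≤ B) && σ k, fun x => rfl, fun k hk _ => ?_⟩
  show (decide (k ≤ B) && σ k) = (decide (B + 1 ≤ B) && σ (B + 1))
  rw [decide_eq_false (by omega : ¬k ≤ B), decide_eq_false (by omega : ¬B + 1 ≤ B),
    Bool.false_and, Bool.false_and]

/-- **The promise parity**: PARITY of `|x|` on the slice `|x| ≤ B`, `false` above it.
[cite: SrinivasanTripathiVenkitesh2021, Definition 14] -/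
def promiseParityFn (n B : ℕ) : (Fin n → Bool) → Bool :=
  slicedFn n B fun k => decide (k % 2 = 1)

/-- On the promise slice the promise parity IS the parity gate `⊕_n` of the tree
(`GateFn.xor`). [cite: SrinivasanTripathiVenkitesh2021, Definition 14] -/
theorem promiseParityFn_eq_xor {B : ℕ} {x : Fin n → Bool} (hx : GateFn.numOnes x ≤ B) :
    promiseParityFn n B x = (GateFn.xor n).2 x := by
  unfold promiseParityFn
  rw [slicedFn_eq_of_le _ hx]
  rfl

/-- The promise parity is `(B+1)`-constant. [cite: SrinivasanTripathiVenkitesh2021, Definition 14] -/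
theorem isTConstant_promiseParityFn (B : ℕ) : IsTConstant (B + 1) (promiseParityFn n B) :=
  isTConstant_slicedFn B _

end TConstant

/-! ### Obs. 15: a `t`-constant function is a `{−1,0,1}`-combination of `Thr_n^0, …, Thr_n^t` -/

section Obs15

variable (F : Type*) [Field F] {n : ℕ}

/-- The coefficients of Obs. 15: `a_0 = [s 0]`, `a_{j+1} = [s(j+1)] − [s j]` (each in `{−1,0,1}`).
[cite: SrinivasanTripathiVenkitesh2021, Observation 15] -/
def tCoeff (s : ℕ → Bool) : ℕ → F
  | 0 => boolVal F (s 0)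
  | j + 1 => boolVal F (s (j + 1)) - boolVal F (s j)

variable {F}

/-- Each coefficient is `0`, `1` or `−1`. [cite: SrinivasanTripathiVenkitesh2021, Observation 15] -/
theorem tCoeff_mem (s : ℕ → Bool) (j : ℕ) :
    tCoeff F s j = 0 ∨ tCoeff F s j = 1 ∨ tCoeff F s j = -1 := by
  cases j with
  | zero => cases h : s 0 <;> simp [tCoeff, boolVal, h]
  | succ j => cases h : s (j + 1) <;> cases h' : s j <;> simp [tCoeff, boolVal, h, h']

/-- Telescoping: `Σ_{j ≤ K} a_j = [s K]`. [cite: SrinivasanTripathiVenkitesh2021, Observation 15] -/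
theorem sum_tCoeff (s : ℕ → Bool) (K : ℕ) :
    ∑ j ∈ range (K + 1), tCoeff F s j = boolVal F (s K) := by
  induction K with
  | zero => simp [tCoeff]
  | succ K ih => rw [Finset.sum_range_succ, ih]; simp [tCoeff]

/-- **Obs. 15** (as an identity in `F` at every point of the cube): if `f x = s(|x|)` and `s` is
constant on `[t, n]`, then `[f x] = Σ_{j=0}^{t} a_j · [Thr_n^j x]` with the coefficients `tCoeff`.
[cite: SrinivasanTripathiVenkitesh2021, Observation 15] -/
theorem IsTConstant.boolVal_eq_sum {t : ℕ} {f : (Fin n → Bool) → Bool} {s : ℕ → Bool}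
    (hs : ∀ x, f x = s (GateFn.numOnes x)) (hc : ∀ k, t ≤ k → k ≤ n → s k = s t)
    (x : Fin n → Bool) :
    boolVal F (f x) = ∑ j ∈ range (t + 1), tCoeff F s j * boolVal F (thrFn n j x) := by
  set w := GateFn.numOnes x with hw
  -- the threshold values: `[Thr^j x] = [j ≤ w]`
  have hthr : ∀ j, boolVal F (thrFn n j x) = if j ≤ w then 1 else 0 := by
    intro j
    by_cases h : j ≤ w <;> simp [thrFn, boolVal, h, ← hw]
  simp_rw [hthr, mul_ite, mul_one, mul_zero]
  rw [← Finset.sum_filter]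
  have hfilter : (range (t + 1)).filter (fun j => j ≤ w) = range (min t w + 1) := by
    ext j
    simp only [Finset.mem_filter, Finset.mem_range]
    omega
  rw [hfilter, sum_tCoeff, hs x, ← hw]
  -- `s (min t w) = s w`
  by_cases htw : t ≤ w
  · rw [min_eq_left htw, hc w htw (hw ▸ numOnes_le x)]
  · rw [min_eq_right (Nat.le_of_not_ge htw)]

end Obs15

/-! ### Closure properties of uniform seed families -/

section Closure

open scoped Classical

variable {F : Type*} [Field F] {n : ℕ} {κ : Type} [Fintype κ]

/-- **Linear post-processing** (the mechanism of STV Cor. 19 / "`pdeg(g ∘ T) ≤ deg g · pdeg(T)`"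
for linear `g`): if the tuple `g = (g_j)_j` has a seed family of degree `≤ D` and error `≤ ε`, and
every `[f_i x]` is a fixed `F`-linear combination `Σ_j a_{ij} [g_j x]`, then `f = (f_i)_i` has a
seed family of the same degree and error (same seeds; a seed correct for all `g_j` is correct for
all `f_i`). [cite: SrinivasanTripathiVenkitesh2021, Corollary 19 (proof)] -/
theorem ufam_of_linComb {κ' : Type} [Fintype κ'] {g : κ' → (Fin n → Bool) → Bool}
    {f : κ → (Fin n → Bool) → Bool} {ε : ℝ} {D : ℕ} (hg : UFam F g ε D) (a : κ → κ' → F)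
    (hf : ∀ i x, boolVal F (f i x) = ∑ j, a i j * boolVal F (g j x)) : UFam F f ε D := by
  obtain ⟨Ω, hΩ, hne, G, hdeg, herr⟩ := hg
  refine ⟨Ω, hΩ, hne, fun ω i => ∑ j, a i j • G ω j,
    fun ω i => Submodule.sum_mem _ fun j _ => Submodule.smul_mem _ _ (hdeg ω j), fun x => ?_⟩
  refine le_trans ?_ (herr x)
  gcongr
  intro ω hω
  rw [mem_errSet] at hω ⊢
  by_contra hall
  push Not at hall
  obtain ⟨i, hi⟩ := hω
  refine hi ?_
  rw [hf i x, Finset.sum_apply]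
  exact Finset.sum_congr rfl fun j _ => by rw [Pi.smul_apply, smul_eq_mul, hall j]

/-- **Composition with a low-degree map of cubes** ("composing the polynomials according to the
structure of the circuit"): if `f = (f_i)_i` on `{0,1}ᵐ` has a seed family of degree `≤ D` and
error `≤ ε`, and every coordinate of `e : {0,1}ⁿ → {0,1}ᵐ` has a `0/1`-indicator of degree
`≤ d₀` over `F`, then `(f_i ∘ e)_i` has a seed family of degree `≤ D·d₀` and error `≤ ε` (same
seeds, `G ω i ∘ e`; the error set at `u` is the error set at `e u`).
[cite: GrewalKumar2024, Thm. 3.8 (proof)] -/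
theorem UFam.comp {m : ℕ} {f : κ → (Fin m → Bool) → Bool} {ε : ℝ} {D d₀ : ℕ} (h : UFam F f ε D)
    (e : (Fin n → Bool) → (Fin m → Bool))
    (he : ∀ i, (fun u => if e u i = true then (1 : F) else 0) ∈ lowDeg F n d₀) :
    UFam F (fun i u => f i (e u)) ε (D * d₀) := by
  obtain ⟨Ω, hΩ, hne, G, hdeg, herr⟩ := h
  exact ⟨Ω, hΩ, hne, fun ω i u => G ω i (e u),
    fun ω i => comp_mem_lowDeg_of_coord_mul e he (hdeg ω i), fun u => herr (e u)⟩

/-- **Joining two seed families** (union bound): families for `f` (error `ε₁`) and `g` (error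
`ε₂`) of degree `≤ D` give one family (product seeds) for the joined tuple `Sum.elim f g` with
error `≤ ε₁ + ε₂`. [cite: GrewalKumar2024, Thm. 3.8 (proof)] -/
theorem UFam.sumElim {κ' : Type} [Fintype κ'] {f : κ → (Fin n → Bool) → Bool}
    {g : κ' → (Fin n → Bool) → Bool} {ε₁ ε₂ : ℝ} {D : ℕ} (hf : UFam F f ε₁ D)
    (hg : UFam F g ε₂ D) : UFam F (Sum.elim f g) (ε₁ + ε₂) D := by
  obtain ⟨Ω₁, hΩ₁, ⟨ω₁⟩, G₁, hdeg₁, herr₁⟩ := hf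
  obtain ⟨Ω₂, hΩ₂, ⟨ω₂⟩, G₂, hdeg₂, herr₂⟩ := hg
  refine ⟨Ω₁ × Ω₂, inferInstance, ⟨(ω₁, ω₂)⟩, fun ω => Sum.elim (G₁ ω.1) (G₂ ω.2), fun ω i => ?_,
    fun x => ?_⟩
  · cases i with
    | inl i => exact hdeg₁ ω.1 i
    | inr j => exact hdeg₂ ω.2 j
  · -- `err ⊆ (err₁ × Ω₂) ∪ (Ω₁ × err₂)`
    have hsub : errSet (fun ω : Ω₁ × Ω₂ => Sum.elim (G₁ ω.1) (G₂ ω.2)) (Sum.elim f g) x ⊆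
        errSet G₁ f x ×ˢ (univ : Finset Ω₂) ∪ (univ : Finset Ω₁) ×ˢ errSet G₂ g x := by
      intro ω hω
      rw [mem_errSet] at hω
      rw [Finset.mem_union, Finset.mem_product, Finset.mem_product, mem_errSet, mem_errSet]
      obtain ⟨i, hi⟩ := hω
      cases i with
      | inl i => exact Or.inl ⟨⟨i, hi⟩, Finset.mem_univ _⟩
      | inr j => exact Or.inr ⟨Finset.mem_univ _, ⟨j, hi⟩⟩
    calc ((errSet (fun ω : Ω₁ × Ω₂ => Sum.elim (G₁ ω.1) (G₂ ω.2)) (Sum.elim f g) x).card : ℝ)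
        ≤ ((errSet G₁ f x ×ˢ (univ : Finset Ω₂) ∪ (univ : Finset Ω₁) ×ˢ errSet G₂ g x).card : ℝ) := by
          exact_mod_cast Finset.card_le_card hsub
      _ ≤ ((errSet G₁ f x).card * Fintype.card Ω₂ + Fintype.card Ω₁ * (errSet G₂ g x).card : ℝ) := by
          have h := Finset.card_union_le (errSet G₁ f x ×ˢ (univ : Finset Ω₂))
            ((univ : Finset Ω₁) ×ˢ errSet G₂ g x)
          rw [Finset.card_product, Finset.card_product, Finset.card_univ, Finset.card_univ] at h
          exact_mod_cast h
      _ ≤ ε₁ * Fintype.card Ω₁ * Fintype.card Ω₂ + Fintype.card Ω₁ * (ε₂ * Fintype.card Ω₂) := by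
          gcongr
          · exact herr₁ x
          · exact herr₂ x
      _ = (ε₁ + ε₂) * Fintype.card (Ω₁ × Ω₂) := by
          rw [Fintype.card_prod, Nat.cast_mul]; ring

/-- **Averaging over the seed** (Razborov's "fix the randomness" step, weighted form): if at every
input at most `ε·|Ω|` seeds err, then for any nonnegative weights `w` on the inputs some single
seed errs on inputs of total weight `≤ ε · Σ_x w x`.
[cite: GrewalKumar2024, Thm. 3.8 (proof, averaging)] -/
theorem exists_seed_weighted_err_le {Ω : Type*} [Fintype Ω] [Nonempty Ω] (G : Ω → κ → CubeFn F n)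
    (f : κ → (Fin n → Bool) → Bool) {ε : ℝ}
    (herr : ∀ x, ((errSet G f x).card : ℝ) ≤ ε * Fintype.card Ω) (w : (Fin n → Bool) → ℝ)
    (hw : ∀ x, 0 ≤ w x) :
    ∃ ω : Ω, ∑ x, (if ω ∈ errSet G f x then w x else 0) ≤ ε * ∑ x, w x := by
  -- the sum over all seeds of the erring weight is `Σ_x w x · |err x| ≤ ε |Ω| Σ_x w x`
  have htot : ∑ ω : Ω, ∑ x, (if ω ∈ errSet G f x then w x else 0) ≤
      ∑ _ω : Ω, ε * ∑ x, w x := by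
    rw [Finset.sum_comm]
    calc ∑ x : Fin n → Bool, ∑ ω : Ω, (if ω ∈ errSet G f x then w x else 0)
        = ∑ x : Fin n → Bool, ((errSet G f x).card : ℝ) * w x := by
          refine Finset.sum_congr rfl fun x _ => ?_
          rw [← Finset.sum_filter, Finset.sum_const, nsmul_eq_mul, Finset.filter_mem_eq_inter,
            Finset.univ_inter]
      _ ≤ ∑ x : Fin n → Bool, ε * Fintype.card Ω * w x :=
          Finset.sum_le_sum fun x _ => mul_le_mul_of_nonneg_right (herr x) (hw x)
      _ = ∑ _ω : Ω, ε * ∑ x, w x := by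
          rw [Finset.sum_const, Finset.card_univ, nsmul_eq_mul, Finset.mul_sum, Finset.mul_sum]
          exact Finset.sum_congr rfl fun x _ => by ring
  obtain ⟨ω, -, hω⟩ := Finset.exists_le_of_sum_le univ_nonempty htot
  exact ⟨ω, hω⟩

/-- **A good realisation on a set of inputs**: a seed family of degree `≤ D` and error `≤ ε`
yields, for every finite set `S` of inputs, ONE tuple of functions of degree `≤ D` that errs on at
most `ε·|S|` points of `S`. [cite: GrewalKumar2024, Thm. 3.8 (proof, averaging)] -/
theorem UFam.exists_realisation {f : κ → (Fin n → Bool) → Bool} {ε : ℝ} {D : ℕ}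
    (h : UFam F f ε D) (S : Finset (Fin n → Bool)) :
    ∃ P : κ → CubeFn F n, (∀ i, P i ∈ lowDeg F n D) ∧
      ((S.filter fun x => ∃ i, P i x ≠ boolVal F (f i x)).card : ℝ) ≤ ε * S.card := by
  obtain ⟨Ω, hΩ, hne, G, hdeg, herr⟩ := h
  obtain ⟨ω, hω⟩ := exists_seed_weighted_err_le G f herr (fun x => if x ∈ S then 1 else 0)
    (fun x => by positivity)
  refine ⟨G ω, hdeg ω, le_trans (le_of_eq ?_) (hω.trans (le_of_eq ?_))⟩
  · -- the erring weight of `ω` is the number of points of `S` at which `G ω` errs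
    have hS : (S.filter fun x => ∃ i, G ω i x ≠ boolVal F (f i x)) =
        S.filter fun x => ω ∈ errSet G f x :=
      Finset.filter_congr fun x _ => mem_errSet.symm
    have hg : ∀ x, (if ω ∈ errSet G f x then (if x ∈ S then (1 : ℝ) else 0) else 0) =
        if x ∈ S then (if ω ∈ errSet G f x then (1 : ℝ) else 0) else 0 := by
      intro x
      by_cases hx : x ∈ S <;> by_cases h : ω ∈ errSet G f x <;> simp [hx, h]
    simp_rw [hg]
    rw [hS, Finset.sum_ite_mem, Finset.univ_inter, Finset.sum_boole]
  · rw [Finset.sum_ite_mem, Finset.univ_inter, Finset.sum_const, nsmul_eq_mul, mul_one]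

end Closure

/-! ### Cor. 19 in positive characteristic: `t`-constant tuples have degree `≤ stvDegree p t ε` -/

section Cor19

variable {n : ℕ} {κ : Type} [Fintype κ]

/-- **STV 2021, Cor. 19 (positive characteristic), tuple / seed-family form**: every finite
family of `t`-constant symmetric functions on `{0,1}ⁿ` has, for every `ε ∈ (0, 2^{-100})`, a
uniform seed family over `𝔽_p` of degree `≤ stvDegree p t ε = ⌊A_p√(t log₂(1/ε)) + B_p log₂(1/ε)⌋`
and JOINT error `≤ ε` — from the threshold tuple `(Thr_n^0, …, Thr_n^t)` (Thm. 18, tree: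
`ufam_thr_stv`) by the linear post-processing of Obs. 15.
[cite: SrinivasanTripathiVenkitesh2021, Corollary 19] -/
theorem ufam_tConstant (p : ℕ) [Fact p.Prime] (f : κ → (Fin n → Bool) → Bool) (t : ℕ)
    (hf : ∀ i, IsTConstant t (f i)) {ε : ℝ} (hε : 0 < ε) (hε' : ε < 1 / 2 ^ 100) :
    UFam (ZMod p) f ε (stvDegree p t ε) := by
  choose s hs hc using hf
  have hthr := ufam_thr_stv p n (Fin (t + 1)) (fun j => (j : ℕ)) t (fun j => Nat.lt_succ_iff.1 j.isLt)
    ε hε hε'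
  refine ufam_of_linComb hthr (fun i j => tCoeff (ZMod p) (s i) j) fun i x => ?_
  rw [IsTConstant.boolVal_eq_sum (F := ZMod p) (hs i) (hc i) x,
    ← Fin.sum_univ_eq_sum_range (fun j => tCoeff (ZMod p) (s i) j * boolVal (ZMod p) (thrFn n j x))]
  rfl

/-- **STV 2021, Cor. 19 (positive characteristic)** in the printed vocabulary (`HasProbDegree`,
Def. 16) over `𝔽_p`: `pdeg_ε(f_1, …, f_m) ≤ stvDegree p t ε` for `t`-constant `f_i`.
[cite: SrinivasanTripathiVenkitesh2021, Corollary 19] -/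
theorem STV2021_tConstantProbDegree (p : ℕ) [Fact p.Prime] {m : ℕ} (f : Fin m → (Fin n → Bool) → Bool)
    (t : ℕ) (hf : ∀ i, IsTConstant t (f i)) {ε : ℝ} (hε : 0 < ε) (hε' : ε < 1 / 2 ^ 100) :
    HasProbDegree (ZMod p) f ε (stvDegree p t ε) :=
  hasProbDegree_of_ufam (ufam_tConstant p f t hf hε hε')

/-- **STV 2021, Cor. 19 over every field of characteristic `p`** (base change along
`ZMod p →+* F`). [cite: SrinivasanTripathiVenkitesh2021, Corollary 19] -/
theorem STV2021_tConstantProbDegree_charP (p : ℕ) [Fact p.Prime] (F : Type*) [Field F] [CharP F p]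
    {m : ℕ} (f : Fin m → (Fin n → Bool) → Bool) (t : ℕ) (hf : ∀ i, IsTConstant t (f i)) {ε : ℝ}
    (hε : 0 < ε) (hε' : ε < 1 / 2 ^ 100) : HasProbDegree F f ε (stvDegree p t ε) :=
  hasProbDegree_of_ufam ((ufam_tConstant p f t hf hε hε').map (ZMod.castHom (dvd_refl p) F))

/-- The single-function case: a `t`-constant `f` has `pdeg_ε(f) ≤ stvDegree p t ε` over `𝔽_p`.
[cite: SrinivasanTripathiVenkitesh2021, Corollary 19] -/
theorem IsTConstant.hasProbDegree (p : ℕ) [Fact p.Prime] {t : ℕ} {f : (Fin n → Bool) → Bool}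
    (hf : IsTConstant t f) {ε : ℝ} (hε : 0 < ε) (hε' : ε < 1 / 2 ^ 100) :
    HasProbDegree (ZMod p) (fun _ : Fin 1 => f) ε (stvDegree p t ε) :=
  STV2021_tConstantProbDegree p _ t (fun _ => hf) hε hε'

/-- Every symmetric Boolean function (`f x = s(|x|)`) is `n`-constant: the constancy condition on
the weights `[n, n]` is empty of content. [cite: SrinivasanTripathiVenkitesh2021, Definition 14] -/
theorem isTConstant_of_symmetric {f : (Fin n → Bool) → Bool} (s : ℕ → Bool)
    (hs : ∀ x, f x = s (GateFn.numOnes x)) : IsTConstant n f :=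
  ⟨s, hs, fun k hk hkn => by rw [le_antisymm hkn hk]⟩

/-- **Alman–Williams 2015 / STV 2021 Lemma 11, over `𝔽_p`, tuple form**: ANY finite family of
symmetric Boolean functions on `{0,1}ⁿ` has a uniform seed family over `𝔽_p` of degree
`≤ stvDegree p n ε = ⌊A_p√(n log₂(1/ε)) + B_p log₂(1/ε)⌋` with joint error `≤ ε` (`ε < 2^{−100}`) —
Cor. 19 at `t = n`. (Printed: "Let `𝔽` be any field. For any `n ≥ 1`, `ε > 0` and `f ∈ sB_n`,
`pdeg_ε^𝔽(f) = O(√(n log(1/ε)))`" [AlmanWilliams2015]; the additive `B_p log₂(1/ε)` term exceeds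
`√(n log(1/ε))` only when `log₂(1/ε) > n`, where degree `n` is trivially available.)
[cite: SrinivasanTripathiVenkitesh2021, Lemma 11 and Corollary 19] -/
theorem ufam_symmetric (p : ℕ) [Fact p.Prime] (f : κ → (Fin n → Bool) → Bool) (s : κ → ℕ → Bool)
    (hs : ∀ i x, f i x = s i (GateFn.numOnes x)) {ε : ℝ} (hε : 0 < ε) (hε' : ε < 1 / 2 ^ 100) :
    UFam (ZMod p) f ε (stvDegree p n ε) :=
  ufam_tConstant p f n (fun i => isTConstant_of_symmetric (s i) (hs i)) hε hε'

/-- **Alman–Williams 2015 / STV 2021 Lemma 11, over `𝔽_p`**: a symmetric Boolean function has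
`pdeg_ε(f) ≤ stvDegree p n ε` (`ε < 2^{−100}`). [cite: SrinivasanTripathiVenkitesh2021, Lemma 11 and Corollary 19] -/
theorem hasProbDegree_symmetric (p : ℕ) [Fact p.Prime] {f : (Fin n → Bool) → Bool} (s : ℕ → Bool)
    (hs : ∀ x, f x = s (GateFn.numOnes x)) {ε : ℝ} (hε : 0 < ε) (hε' : ε < 1 / 2 ^ 100) :
    HasProbDegree (ZMod p) (fun _ : Fin 1 => f) ε (stvDegree p n ε) :=
  (isTConstant_of_symmetric s hs).hasProbDegree p hε hε'

end Cor19

/-! ### Sliced symmetric functions / the promise parity read through low-degree `0/1` maps -/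

section Promise

variable {n m : ℕ} {κ : Type} [Fintype κ]

/-- **Sliced symmetric reads through a low-degree map**: for `0/1`-valued coordinate maps
`e : {0,1}ⁿ → {0,1}ᵐ` with indicators of degree `≤ D` over `𝔽_p` and any family of symmetric
functions `σ_i` sliced at weight `B`, the family `u ↦ slicedFn m B σ_i (e u)` has a seed family over
`𝔽_p` of degree `≤ stvDegree p (B+1) ε · D` and JOINT error `≤ ε` at every input `u`.
[cite: SrinivasanTripathiVenkitesh2021, Corollary 19] -/
theorem ufam_sliced_comp (p : ℕ) [Fact p.Prime] (B : ℕ) (σ : κ → ℕ → Bool)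
    (e : (Fin n → Bool) → (Fin m → Bool)) {D : ℕ}
    (he : ∀ i, (fun u => if e u i = true then (1 : ZMod p) else 0) ∈ lowDeg (ZMod p) n D)
    {ε : ℝ} (hε : 0 < ε) (hε' : ε < 1 / 2 ^ 100) :
    UFam (ZMod p) (fun i u => slicedFn m B (σ i) (e u)) ε (stvDegree p (B + 1) ε * D) :=
  (ufam_tConstant p (fun i => slicedFn m B (σ i)) (B + 1) (fun i => isTConstant_slicedFn B (σ i))
    hε hε').comp e he

/-- **The promise parity read through a low-degree map** (the input of the `√n`-shots rung of the
advice-free `QNC⁰` cell): for `0/1`-valued maps `e_1, …, e_m` on `{0,1}ⁿ` with indicators of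
degree `≤ D` over `𝔽_p`, the function `u ↦ promiseParityFn m B (e u)` — which is the parity
`⊕_i e_i(u)` at every `u` with at most `B` of the `e_i(u)` set (`promiseParityFn_comp_eq`) — has a
seed family over `𝔽_p` of degree `≤ stvDegree p (B+1) ε · D = O_p(D(√(B log(1/ε)) + log(1/ε)))`
and error `≤ ε` at EVERY input. [cite: SrinivasanTripathiVenkitesh2021, Corollary 19] -/
theorem ufam_promiseParity_comp (p : ℕ) [Fact p.Prime] (B : ℕ) (e : (Fin n → Bool) → (Fin m → Bool))
    {D : ℕ} (he : ∀ i, (fun u => if e u i = true then (1 : ZMod p) else 0) ∈ lowDeg (ZMod p) n D)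
    {ε : ℝ} (hε : 0 < ε) (hε' : ε < 1 / 2 ^ 100) :
    UFam (ZMod p) (fun (_ : Fin 1) u => promiseParityFn m B (e u)) ε (stvDegree p (B + 1) ε * D) :=
  ufam_sliced_comp p B (fun _ k => decide (k % 2 = 1)) e he hε hε'

/-- What the composed promise parity computes: the parity of the bits `e u` whenever at most `B`
of them are set. [cite: SrinivasanTripathiVenkitesh2021, Definition 14] -/
theorem promiseParityFn_comp_eq {B : ℕ} (e : (Fin n → Bool) → (Fin m → Bool)) {u : Fin n → Bool}
    (hu : GateFn.numOnes (e u) ≤ B) : promiseParityFn m B (e u) = (GateFn.xor m).2 (e u) :=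
  promiseParityFn_eq_xor hu

/-- `HasProbDegree` form of `ufam_promiseParity_comp`. [cite: SrinivasanTripathiVenkitesh2021, Corollary 19] -/
theorem hasProbDegree_promiseParity_comp (p : ℕ) [Fact p.Prime] (B : ℕ)
    (e : (Fin n → Bool) → (Fin m → Bool)) {D : ℕ}
    (he : ∀ i, (fun u => if e u i = true then (1 : ZMod p) else 0) ∈ lowDeg (ZMod p) n D)
    {ε : ℝ} (hε : 0 < ε) (hε' : ε < 1 / 2 ^ 100) :
    HasProbDegree (ZMod p) (fun (_ : Fin 1) u => promiseParityFn m B (e u)) ε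
      (stvDegree p (B + 1) ε * D) :=
  hasProbDegree_of_ufam (ufam_promiseParity_comp p B e he hε hε')

end Promise

/-! ### Boolean post-processing; one seed good on most fibres (appended, qn-lit g16)

Two more closure steps of the polynomial method in seed-family form: (i) a tuple
`(f_1, …, f_k)` realised by a seed family of degree `≤ D` yields, for ANY Boolean functions
`φ_j : {0,1}ᵏ → {0,1}`, a seed family for `(φ_j(f_1, …, f_k))_j` of degree `≤ k·D` with the same
seeds and error (substitute into the exact multilinear polynomial of `φ_j`; `eval_fn_mem_lowDeg`) —
e.g. every level set of a map that factors through `k` realised bits; (ii) Markov over a partition of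
the inputs into fibres: one seed errs on more than a `t`-fraction of the fibre of at most
`ε·2ⁿ/t` points. -/

section Post

open scoped Classical

variable {F : Type*} [Field F] {n : ℕ} {κ : Type} [Fintype κ]

/-- **Boolean post-processing** ("the output gate is applied to the polynomials of its inputs"):
if `(f_i)_{i<k}` has a seed family of degree `≤ D` and error `≤ ε`, then for every family of
Boolean functions `φ_j : {0,1}ᵏ → {0,1}` the tuple `u ↦ φ_j(f_0 u, …, f_{k-1} u)` has a seed family
of degree `≤ k·D` and error `≤ ε` (same seeds: the exact multilinear polynomial of `φ_j`, of
degree `≤ k`, evaluated at the `k` seed functions; a seed correct for all `f_i` is correct for all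
`φ_j ∘ f`). [cite: GrewalKumar2024, Thm. 3.8 (proof)] -/
theorem UFam.boolPost {k : ℕ} {κ' : Type} [Fintype κ'] {f : Fin k → (Fin n → Bool) → Bool}
    {ε : ℝ} {D : ℕ} (h : UFam F f ε D) (φ : κ' → (Fin k → Bool) → Bool) :
    UFam F (fun j u => φ j (fun i => f i u)) ε (k * D) := by
  obtain ⟨Ω, hΩ, hne, G, hdeg, herr⟩ := h
  have hP : ∀ j, ∃ P : MvPolynomial (Fin k) F, P.totalDegree ≤ k ∧
      ∀ b, boolVal F (φ j b) = MvPolynomial.eval (fun i => if b i then (1 : F) else 0) P :=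
    fun j => exists_poly_of_mem_lowDeg (mem_lowDeg_self (fun b => boolVal F (φ j b)))
  choose P hPdeg hPeval using hP
  refine ⟨Ω, hΩ, hne, fun ω j u => MvPolynomial.eval (fun i => G ω i u) (P j),
    fun ω j => eval_fn_mem_lowDeg (P j) (hPdeg j) (fun i => G ω i) (fun i => hdeg ω i),
    fun u => ?_⟩
  have hsub : errSet (fun ω j u => MvPolynomial.eval (fun i => G ω i u) (P j))
      (fun j u => φ j (fun i => f i u)) u ⊆ errSet G f u := by
    intro ω hω
    rw [mem_errSet] at hω ⊢
    by_contra hall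
    push Not at hall
    obtain ⟨j, hj⟩ := hω
    apply hj
    show MvPolynomial.eval (fun i => G ω i u) (P j) = boolVal F (φ j (fun i => f i u))
    rw [hPeval j]
    congr 2
    funext i
    rw [hall i]
    cases f i u <;> simp [boolVal]
  exact le_trans (by exact_mod_cast Finset.card_le_card hsub) (herr u)

/-- **One seed is good on most fibres** (averaging + Markov): partition the inputs into the
fibres of a map `fib`; call a point BAD for the seed `ω` if `ω` errs on more than a `t`-fraction
of its fibre. Some seed has at most `ε·2ⁿ/t` bad points (stated as `t·#bad ≤ ε·2ⁿ`): take a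
seed erring on `≤ ε·2ⁿ` inputs (averaging), then `t·#bad = Σ_{bad fibres} t·|fibre| <
Σ_{bad fibres} #errors ≤ #errors`. [cite: GrewalKumar2024, Thm. 3.8 (proof, averaging)] -/
theorem exists_seed_few_bad_fibres {Ω : Type*} [Fintype Ω] [Nonempty Ω] {β : Type*}
    [DecidableEq β] (G : Ω → κ → CubeFn F n) (f : κ → (Fin n → Bool) → Bool) {ε : ℝ}
    (herr : ∀ x, ((errSet G f x).card : ℝ) ≤ ε * Fintype.card Ω) (fib : (Fin n → Bool) → β)
    (t : ℝ) :
    ∃ ω : Ω, t * ((univ.filter fun x : Fin n → Bool =>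
        t * ((univ.filter fun y : Fin n → Bool => fib y = fib x).card : ℝ) <
          ((univ.filter fun y : Fin n → Bool => fib y = fib x ∧ ω ∈ errSet G f y).card : ℝ)).card
        : ℝ) ≤ ε * 2 ^ n := by
  obtain ⟨ω, hω⟩ := exists_seed_weighted_err_le G f herr (fun _ => (1 : ℝ)) fun _ => zero_le_one
  refine ⟨ω, ?_⟩
  -- the error set `E` of `ω` and its size
  set E : Finset (Fin n → Bool) := univ.filter fun y => ω ∈ errSet G f y with hE
  have hEcard : (E.card : ℝ) ≤ ε * 2 ^ n := by
    have h1 : (E.card : ℝ) = ∑ x : Fin n → Bool, (if ω ∈ errSet G f x then (1 : ℝ) else 0) := by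
      rw [Finset.sum_boole]
    have h2 : ∑ _x : Fin n → Bool, (1 : ℝ) = 2 ^ n := by
      simp [Finset.card_univ]
    rw [h1]
    rw [h2] at hω
    exact hω
  -- fibres and bad points
  set fibre : β → Finset (Fin n → Bool) := fun b => univ.filter fun y => fib y = b with hfibre
  set Bad : Finset (Fin n → Bool) := univ.filter fun x =>
    t * ((fibre (fib x)).card : ℝ) < ((fibre (fib x) ∩ E).card : ℝ) with hBad
  have hgoal : (univ.filter fun x : Fin n → Bool =>
      t * ((univ.filter fun y : Fin n → Bool => fib y = fib x).card : ℝ) <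
        ((univ.filter fun y : Fin n → Bool => fib y = fib x ∧ ω ∈ errSet G f y).card : ℝ)) = Bad := by
    refine Finset.filter_congr fun x _ => ?_
    rw [Finset.filter_and]
  rw [hgoal]
  -- `#Bad` fibrewise: every fibre meeting `Bad` lies inside `Bad`
  have hmaps : ∀ x ∈ Bad, fib x ∈ Bad.image fib := fun x hx => Finset.mem_image_of_mem fib hx
  have hcardBad : (Bad.card : ℝ) = ∑ b ∈ Bad.image fib, ((fibre b).card : ℝ) := by
    rw [Finset.card_eq_sum_card_fiberwise hmaps, Nat.cast_sum]
    refine Finset.sum_congr rfl fun b hb => ?_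
    obtain ⟨x, hx, rfl⟩ := Finset.mem_image.1 hb
    congr 2
    ext y
    simp only [hBad, hfibre, Finset.mem_filter, Finset.mem_univ, true_and] at hx ⊢
    constructor
    · rintro ⟨_, hy⟩; exact hy
    · intro hy; rw [hy]; exact ⟨hx, rfl⟩
  -- each bad fibre: `t·|fibre| < #(fibre ∩ E)`
  have hbadB : ∀ b ∈ Bad.image fib, t * ((fibre b).card : ℝ) ≤ ((fibre b ∩ E).card : ℝ) := by
    intro b hb
    obtain ⟨x, hx, rfl⟩ := Finset.mem_image.1 hb
    simp only [hBad, Finset.mem_filter, Finset.mem_univ, true_and] at hx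
    exact hx.le
  -- the fibres partition `E`
  have hEsum : ∑ b ∈ (univ : Finset (Fin n → Bool)).image fib, ((fibre b ∩ E).card : ℝ) = E.card := by
    rw [Finset.card_eq_sum_card_fiberwise (fun y _ => Finset.mem_image_of_mem fib (Finset.mem_univ y)),
      Nat.cast_sum]
    refine Finset.sum_congr rfl fun b _ => ?_
    congr 2
    ext y
    simp [hfibre, hE, and_comm]
  calc t * (Bad.card : ℝ) = ∑ b ∈ Bad.image fib, t * ((fibre b).card : ℝ) := by
        rw [hcardBad, Finset.mul_sum]
    _ ≤ ∑ b ∈ Bad.image fib, ((fibre b ∩ E).card : ℝ) := Finset.sum_le_sum hbadB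
    _ ≤ ∑ b ∈ (univ : Finset (Fin n → Bool)).image fib, ((fibre b ∩ E).card : ℝ) :=
        Finset.sum_le_sum_of_subset_of_nonneg
          (Finset.image_subset_image (Finset.subset_univ Bad)) fun b _ _ => Nat.cast_nonneg _
    _ = E.card := hEsum
    _ ≤ ε * 2 ^ n := hEcard

end Post

/-! ### Finset-indexed form of the promise parity (appended, qn-lit g16)

The consumer's shape in the shots ladder: cuts `g ∈ S` (a `Finset` of an arbitrary index type), bits
`y g u`, the count `#{g ∈ S : y g u}` promised `≤ B`, and its parity. -/

section FinsetForm

open scoped Classical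

variable {n : ℕ}

/-- Counting through an enumeration: for `S.equivFin : S ≃ Fin |S|`, the number of `true` bits of
`i ↦ y (S.equivFin⁻¹ i) u` is `#{g ∈ S : y g u}`. [folklore] -/
private theorem numOnes_enum {ι : Type} (S : Finset ι) (y : ι → (Fin n → Bool) → Bool)
    (u : Fin n → Bool) :
    GateFn.numOnes (fun i : Fin S.card => y (S.equivFin.symm i).1 u) =
      (S.filter fun g => y g u = true).card := by
  unfold GateFn.numOnes
  rw [Finset.card_filter, Finset.card_filter]
  calc (∑ i : Fin S.card, if (fun i => y (S.equivFin.symm i).1 u) i = true then 1 else 0)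
      = ∑ g : S, if y g.1 u = true then 1 else 0 :=
        Fintype.sum_equiv S.equivFin.symm _ (fun g : S => if y g.1 u = true then 1 else 0) fun _ => rfl
    _ = ∑ g ∈ S, if y g u = true then 1 else 0 :=
        Finset.sum_coe_sort S (fun g => if y g u = true then 1 else 0)

/-- **The promise parity of a `Finset`-indexed family of low-degree bits**: for bits `y g`,
`g ∈ S`, whose `0/1`-indicators have degree `≤ D` over `𝔽_p`, the function
`u ↦ [#{g ∈ S : y g u} ≤ B ∧ #{g ∈ S : y g u} odd]` (the parity of the `S`-bits wherever at most
`B` of them are set, `false` elsewhere) has a seed family over `𝔽_p` of degree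
`≤ stvDegree p (B+1) ε · D` and error `≤ ε` at every input.
[cite: SrinivasanTripathiVenkitesh2021, Corollary 19] -/
theorem ufam_promiseParity_finset (p : ℕ) [Fact p.Prime] {ι : Type} (S : Finset ι) (B : ℕ)
    (y : ι → (Fin n → Bool) → Bool) {D : ℕ}
    (hy : ∀ g ∈ S, (fun u => if y g u = true then (1 : ZMod p) else 0) ∈ lowDeg (ZMod p) n D)
    {ε : ℝ} (hε : 0 < ε) (hε' : ε < 1 / 2 ^ 100) :
    UFam (ZMod p) (fun (_ : Fin 1) u =>
        decide ((S.filter fun g => y g u = true).card ≤ B) &&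
          decide ((S.filter fun g => y g u = true).card % 2 = 1)) ε (stvDegree p (B + 1) ε * D) := by
  have h := ufam_promiseParity_comp p B (fun u (i : Fin S.card) => y (S.equivFin.symm i).1 u)
    (fun i => hy _ (S.equivFin.symm i).2) hε hε'
  have hfun : (fun (_ : Fin 1) u => promiseParityFn S.card B
      (fun i : Fin S.card => y (S.equivFin.symm i).1 u)) =
      fun (_ : Fin 1) u => decide ((S.filter fun g => y g u = true).card ≤ B) &&
        decide ((S.filter fun g => y g u = true).card % 2 = 1) := by
    funext j u
    simp only [promiseParityFn, slicedFn, numOnes_enum]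
  rw [hfun] at h
  exact h

/-- The same for ANY symmetric read `σ` of the count `#{g ∈ S : y g u}` on the slice `≤ B`
(e.g. all exact-count indicators jointly, `κ`-indexed). [cite: SrinivasanTripathiVenkitesh2021, Corollary 19] -/
theorem ufam_sliced_finset (p : ℕ) [Fact p.Prime] {ι : Type} (S : Finset ι) (B : ℕ)
    {κ : Type} [Fintype κ] (σ : κ → ℕ → Bool) (y : ι → (Fin n → Bool) → Bool) {D : ℕ}
    (hy : ∀ g ∈ S, (fun u => if y g u = true then (1 : ZMod p) else 0) ∈ lowDeg (ZMod p) n D)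
    {ε : ℝ} (hε : 0 < ε) (hε' : ε < 1 / 2 ^ 100) :
    UFam (ZMod p) (fun i u =>
        decide ((S.filter fun g => y g u = true).card ≤ B) &&
          σ i (S.filter fun g => y g u = true).card) ε (stvDegree p (B + 1) ε * D) := by
  have h := ufam_sliced_comp p B σ (fun u (i : Fin S.card) => y (S.equivFin.symm i).1 u)
    (fun i => hy _ (S.equivFin.symm i).2) hε hε'
  have hfun : (fun i u => slicedFn S.card B (σ i)
      (fun j : Fin S.card => y (S.equivFin.symm j).1 u)) =
      fun i u => decide ((S.filter fun g => y g u = true).card ≤ B) &&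
        σ i (S.filter fun g => y g u = true).card := by
    funext i u
    simp only [slicedFn, numOnes_enum]
  rw [hfun] at h
  exact h

end FinsetForm

end Smolensky

end Literature.Computability.MetaComplexity
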